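import Literature.MathematicalPhysics.QuantumFieldTheory.Balaban1983to89.B9Eq326DeltaABlockDecay
import Literature.MathematicalPhysics.QuantumFieldTheory.Balaban1983to89.B9Eq349ConjugatedProjectionDifferenceChain
import Literature.MathematicalPhysics.QuantumFieldTheory.Balaban1983to89.B9Eq349ConjugatedQLettersCompanion
import Literature.MathematicalPhysics.QuantumFieldTheory.Balaban1983to89.B9Eq325ProjectionDivergenceQuarterKappa

/-!
# `Balaban1983to89.B9Eq326DeltaAHQKLetters` — T. Bałaban, *Propagators for lattice gauge theories in a background field*, Commun. Math. Phys. **99** (1985)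
# 389–434 [Balaban1985BackgroundPropagators] (3.26) p. 395, (3.15) p. 393, (3.21)∕(3.25) p. 394, (3.49) p. 399, (3.69) p. 404, Thm 3.11 p. 416, with
# [Balaban1985Variational] (110) p. 294: **THE FOUR CONJUGATION LETTERS `dQ ∧ dQ′ ∧ dK ∧ dR` OF ROAD ΔA-CT INHABITED AT THE CHAIN — the `hQK` binder of
# ne9-leaf-03's (GBD v2) `B9Eq326DeltaABlockDecay.norm_block_G1ofU_le` ∕ (H1D) ∕ (EH1) at print's one-step vector averaging `Q(U) := QtorusW`, the curvature
# part `Δ′(U)` and the projection `R(U)`, for EVERY fine weight, one-block companion, multiplier triple and `κ` on the circle `‖κ‖ = r`** — from gen 94's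
# companion letters (`B9Eq349ConjugatedQLettersCompanion`: `dQ`, `dQ′`, `dK`) and ne9-leaf-03's `dR` chain (`B9Eq349ConjugatedProjectionDifferenceChain.
# norm_conjRofU_sub_RofU_le_sqrtKappa`); and THE COROLLARY: the `L²` block decay of `G₁(U) = Δ_a(U)⁻¹` with `hQK` DISCHARGED — displayed then: `γ`
# (Thm 3.11 for `Δ_a`), `γ′`∕`a′` (the coercivity of `Δ′_{a′}(U)` behind `G′`), `κ₁` (the `Q̃′G′²Q̃′†` floor), `M` (`‖Q̃′‖`), `C_P`, the MODEL letters and CLOSED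
# radius windows

statement-level skeleton of published theorems with citation tags; proofs where landed; nothing here is a claim about the Yang–Mills mass gap

CITATION HEADER (lean-in-tree rule).  Audit cell `pub-balaban`, sub-cell `t4`, BINDER row NE9; filed by the NE9 BINDER-row OWNER lineage
`b2b-balaban-t4-ne9-p1` (gen 94).  Imports ne9-leaf-03's (GBD v2) `B9Eq326DeltaABlockDecay` (the END with `hQK` displayed), ne9-leaf-03's (PDC)
`B9Eq349ConjugatedProjectionDifferenceChain` (the `dR` letter at the chain: `‖SR(U)S⁻¹ − R(U)‖ ≤ 15β′s_A∕√κ₁`, ne9-leaf-06's DP chain + t4-ne9-idea-1 g141's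
kernel behind it) and gen 94's `B9Eq349ConjugatedQLettersCompanion` (`norm_expConj_QtorusW_sub_le`, `norm_expConj_adjoint_QtorusW_sub_le`,
`norm_expConj_curvOp_sub_le`); road B8″'s `B9Eq387IMSLocalLettersLattice.exists_pointwise_clm` (the coarse-site multiplier), (G) `B9Eq3101ExpPointwiseMultiplier`.
Sources READ first-hand (`paper:balaban1985-cmp99-background-propagators`): p. 395 (3.26), p. 393 (3.15), p. 394 (3.21)∕(3.25), p. 399 (3.49), p. 404 (3.69),
p. 416 Thm 3.11; [Balaban1985Variational] p. 294 (110).  Print's decay proof is the random walk of Sect. C; everything here is the ROUTE's Combes–Thomas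
bookkeeping; no rate or constant of print is asserted.

WHAT IS PROVED (sorry-free; proof lane — no `def`; [folklore] composition BY NAME).  One-step torus `T_{(L·m)} → T_m`; `𝔸`, fibre `φ` (`M_φ, M_φ′`,
`‖X⋆‖ ≤ ‖X‖`), weights `c₀`, `c₁ = L^d c₀`; background `U` (`U(b) ∈ U1`, `hRS`, (3.35)-type `hα1 hU1 hreg` + flat twins, `‖U(b) − 1‖ ≤ ε_U`, plaquette
smallness `δ`), trace datum `‖τ(XY)‖ ≤ M_τ‖X‖‖Y‖`; `a′ ≥ 0` with the positivity of `Δ′_{a′}(U)` (`hpos′`), its coercivity `γ′` in the (3.23) form, the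
floor `κ₁` of `Q̃′G′²Q̃′†`, the size `M` of `Q̃′`.  Radius `r` with CLOSED windows: `rℓη ≤ 1`, `r(3ℓ′ + Lℓη) ≤ 1`, `rℓ′ ≤ 1`, `2r(3ℓ′ + Lℓη)·M_φ′M_φ·√(2(c₁∕c₀)
(2d(102(d+1)²Lε_U)² + (L^d)⁻¹)) ≤ β`, `8rℓη·p_K ≤ β_K`, `2rℓM_φM_φ′√d ≤ β′`, `2rℓ′(1 + 2M_φM_φ′ε_U)^{d(L−1)} ≤ β′`, `β′ ≤ 1`, `3(1+a′)β′² ≤ γ′∕4`, `12s_Aβ′ ≤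
√κ₁` (`s_A = 4∕γ′ + M(4∕γ′)²(3 + a′(2M+1))`), `15β′s_A∕√κ₁ ≤ ρ`.
* §1 **`hQK_of_chain`** — the binder: `∀ χ χ′ (increments ≤ ℓη) (one-block companion ≤ ℓ′) M_B M_S M_F κ (‖κ‖ = r), dQ(β) ∧ dQ′(β) ∧ dK(β_K) ∧ dR(ρ)`
  at `Q := QtorusW`, `Δ′ := curvOp φ τ η U`, `R := RofU L m φ η U`.
* §2 **`norm_block_G1ofU_le_closedLetters`** — (GBD v2) with `hQK := hQK_of_chain …`: `‖P_{y₁} ∘ G₁(U) ∘ P_{y₀}‖ ≤ (4∕γ)·e^{r}·e^{−r·d_m(y₀,y₁)}` for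
  `Δ_a(U)` at `Q := QtorusW`, displayed: `γ`, `γ′, a′, hpos′, κ₁, M`, `C_P` + `hP`, and the windows above with `ρ ≤ 1∕8`, `p_K∕2 + (21+3a)β² + 4βC_P +
  2ρC_P² + β_K ≤ γ∕4` (the `p_K` floor itself discharged by g92's `B9Eq369CurvFormL2.re_inner_curvOp_self_ge`).
* §3 **`norm_block_G1ofU_le_closed`** — §2 with `hP` DISCHARGED by ne9-leaf-03's `B9Eq325ProjectionDivergenceQuarterKappa.norm_one_sub_RofU_covDivL2K_le_sqrt`
  (`C_P := √(M∕√κ₁)`): the `L²` block decay of `G₁(U)` given ONLY the Thm-3.11-currency letters (`γ`, `hpos`; `γ′`, `a′`, `hpos′`, `κ₁`, `M`), the MODEL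
  letters and CLOSED windows.
HONEST SCOPE.  Composition; every Thm-3.11-currency letter (`γ`, `γ′`, `κ₁`, `hpos`, `hpos′`) and `C_P`, `M` DISPLAYED; one step; crude constants; nothing
of [B9] Thm 3.1∕3.3∕3.11 asserted, valued or discharged; «NE9 ⇐ the named binders»; NE9 NOT PRINTED ∕ NOT PROVED; row WALLED ON A MODEL (O-NE9-1; #5
UNRULED); spine PROVED 0∕9; rung (B)+1 on a finite T⁴ — NOT infinite volume, NOT mass gap, NOT BetaPertH, NOT Clay.  HONEST DEPENDENCY: continuum YM on T⁴ ⇐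
BetaPertH ∧ nine spine estimates (0/9 proved); BetaPertH ⇐ (D1) ∧ (D4) ∧ CAP+tail.  NEW file; nothing modified.  Net new unproved facts: 0.
-/

noncomputable section

set_option autoImplicit false

open scoped InnerProductSpace ComplexConjugate BigOperators
open NormedSpace

namespace Literature.MathematicalPhysics.QuantumFieldTheory.Balaban1983to89.B9Eq326DeltaAHQKLetters

open B4Sect5Torus (TSite tdist)
open B9SectCLatticeCarrier (Bond DirPair bpos btgt)
open B9Eq311L2Pairing (WL2)
open B9Eq319QprimeTorus (fineP blockCoord)
open B7Prop1Explicit (U1 Wcx boxVec)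
open B11Eq103H1Complex (SiteL2K BondL2K covDerivL2K covDivL2K)
open B9Eq310DeltaPrime (reHol imHol)
open B9Eq310HessianOperator (adTransportW curvOp)
open B9Eq315QTorus (perCfg cornerSite QtorusW)
open B9Eq326OperatorAssembly (QprimeW RofU laplaceAofU G1ofU)
open B9Eq3119DeltaPiCarrier (laplacePrimeA GpOfU)
open B9Eq326DeltaABlockDecay (norm_block_G1ofU_le)
open B9Eq349ConjugatedProjectionDifferenceChain (norm_conjRofU_sub_RofU_le_sqrtKappa)
open B9Eq349ConjugatedQLettersCompanion (norm_expConj_QtorusW_sub_le norm_expConj_adjoint_QtorusW_sub_le norm_expConj_curvOp_sub_le)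
open B9Eq369CurvFormL2 (re_inner_curvOp_self_ge)
open B9Eq3101ExpPointwiseMultiplier (equiv_exp_smul_apply_complex equiv_exp_smul_neg_apply_complex)
open B9Eq387IMSLocalLettersLattice (exists_pointwise_clm)

variable {d : ℕ} (L : ℕ) [NeZero L] (m : Fin d → ℕ) [∀ i, NeZero (fineP L m i)]
  {𝔸 : Type*} [NormedRing 𝔸] [StarRing 𝔸] [NormedAlgebra ℂ 𝔸] [StarModule ℂ 𝔸] [NormOneClass 𝔸] [CompleteSpace 𝔸] (hL : 1 ≤ L)
  {W : Type*} [NormedAddCommGroup W] [InnerProductSpace ℂ W] [FiniteDimensional ℂ W] (φ : W ≃ₗ[ℂ] 𝔸) {Mφ Mφ' : ℝ}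
  (hφ : ∀ w, ‖φ w‖ ≤ Mφ * ‖w‖) (hφ' : ∀ X, ‖φ.symm X‖ ≤ Mφ' * ‖X‖) (hMφ : 0 ≤ Mφ) (hMφ' : 0 ≤ Mφ') (hstar : ∀ X : 𝔸, ‖star X‖ ≤ ‖X‖)
  {c₀ c₁ : ℝ} [Fact (0 < c₀)] [Fact (0 < c₁)] (hc : c₁ = (L : ℝ) ^ d * c₀) {η : ℝ} (hη : 0 < η) (hηL : η * L = 1)
  (U : Bond d (fineP L m) → 𝔸ˣ) (hU : ∀ b, U b ∈ U1 𝔸)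
  (hRS : ∀ (b : Bond d (fineP L m)) (v u : W), ⟪adTransportW φ U b v, u⟫_ℂ = ⟪v, adTransportW φ (fun b => (U b)⁻¹) b u⟫_ℂ)
  {α : ℝ} (hα1 : α ≤ 1 / 64)
  (hU1 : ∀ (x : B7Prop1Explicit.Site d) (k : Fin d), perCfg (fineP L m) U x k ∈ U1 𝔸)
  (hreg : ∀ (y : TSite d m) (k : Fin d) (ρ' : Fin d → Fin L),
    ‖((Wcx L (perCfg (fineP L m) U) (cornerSite L y) k (boxVec L ρ') : 𝔸ˣ) : 𝔸) - 1‖ ≤ α)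
  {α' : ℝ} (hα1' : α' ≤ 1 / 64)
  (hU1' : ∀ (x : B7Prop1Explicit.Site d) (k : Fin d), perCfg (fineP L m) (fun _ : Bond d (fineP L m) => (1 : 𝔸ˣ)) x k ∈ U1 𝔸)
  (hreg' : ∀ (y : TSite d m) (k : Fin d) (ρ' : Fin d → Fin L),
    ‖((Wcx L (perCfg (fineP L m) (fun _ : Bond d (fineP L m) => (1 : 𝔸ˣ))) (cornerSite L y) k (boxVec L ρ') : 𝔸ˣ) : 𝔸) - 1‖ ≤ α')
  {εU : ℝ} (hεU : 0 ≤ εU) (hUε : ∀ b : Bond d (fineP L m), ‖(U b : 𝔸) - 1‖ ≤ εU)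
  (τ : 𝔸 →ₗ[ℂ] ℂ) {Mτ : ℝ} (hτ : ∀ X Y : 𝔸, ‖τ (X * Y)‖ ≤ Mτ * ‖X‖ * ‖Y‖) (hMτ : 0 ≤ Mτ)
  {δ : ℝ} (hδ : 0 ≤ δ)
  (hRe : ∀ p : B9SectCLatticeCarrier.Plaq d (fineP L m), ‖reHol U p - 1‖ ≤ δ)
  (hIm : ∀ p : B9SectCLatticeCarrier.Plaq d (fineP L m), ‖imHol U p‖ ≤ δ)
  -- the `G′`-side letters of the `dR` chain
  {a' : ℝ} (ha' : 0 ≤ a')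
  (hpos' : ∀ x : SiteL2K ℂ d (fineP L m) c₀ W, x ≠ 0 → 0 < RCLike.re ⟪x, laplacePrimeA L m φ η U a' (c₁ := c₁) x⟫_ℂ)
  {γ' κ₁ M : ℝ} (hγ' : 0 < γ') (hγ'1 : γ' ≤ 1) (hκ₁ : 0 < κ₁) (hM : 0 ≤ M)
  (coercive : ∀ f : SiteL2K ℂ d (fineP L m) c₀ W, γ' * ‖f‖ ^ 2 ≤ ‖(covDerivL2K ℂ c₀ ((η : ℂ))⁻¹ (adTransportW φ U)) f‖ ^ 2 +
    a' * ‖((WL2.linearEquiv ℂ ℂ (fun _ : TSite d m => c₁)).symm.toLinearMap ∘ₗ QprimeW L m φ U (c₀ := c₀)) f‖ ^ 2)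
  (hκ : ∀ ψ : SiteL2K ℂ d m c₁ W, κ₁ * ‖ψ‖ ^ 2 ≤ RCLike.re ⟪ψ,
    (((WL2.linearEquiv ℂ ℂ (fun _ : TSite d m => c₁)).symm.toLinearMap ∘ₗ QprimeW L m φ U (c₀ := c₀)) ∘ₗ
      GpOfU L m φ η U a' (c₁ := c₁) hpos' ∘ₗ GpOfU L m φ η U a' (c₁ := c₁) hpos' ∘ₗ
      LinearMap.adjoint ((WL2.linearEquiv ℂ ℂ (fun _ : TSite d m => c₁)).symm.toLinearMap ∘ₗ QprimeW L m φ U (c₀ := c₀))) ψ⟫_ℂ)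
  (hMQ : ∀ s : SiteL2K ℂ d (fineP L m) c₀ W, ‖((WL2.linearEquiv ℂ ℂ (fun _ : TSite d m => c₁)).symm.toLinearMap ∘ₗ QprimeW L m φ U (c₀ := c₀)) s‖ ≤ M * ‖s‖)
  -- the radius and the CLOSED windows
  {r ℓ ℓ' β βK β' ρ : ℝ} (hr : 0 ≤ r) (hℓ : 1 ≤ ℓ) (hℓ' : 1 ≤ ℓ') (hβ'0 : 0 ≤ β') (hβ'1 : β' ≤ 1)
  (hwin : r * ℓ * η ≤ 1) (hwinQ : r * (3 * ℓ' + L * (ℓ * η)) ≤ 1) (hwin' : r * ℓ' ≤ 1)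
  (hβQ : 2 * (r * (3 * ℓ' + L * (ℓ * η))) * (Mφ' * Mφ * Real.sqrt (2 * (c₁ / c₀) * (2 * d * (102 * (d + 1) ^ 2 * L * εU) ^ 2 + ((L : ℝ) ^ d)⁻¹))) ≤ β)
  (hβK : 8 * (r * (ℓ * η)) * (768 * Fintype.card (DirPair d) * Mτ * Mφ ^ 2 * (‖((η : ℂ)) ^ d‖ / c₀) * ‖((η : ℂ))⁻¹‖ ^ 2 * δ) ≤ βK)
  (hβ'D : 2 * r * ℓ * (Mφ * Mφ') * Real.sqrt d ≤ β') (hβ'Q : 2 * r * ℓ' * (1 + 2 * Mφ * Mφ' * εU) ^ (d * (L - 1)) ≤ β')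
  (small' : 3 * (1 + a') * β' ^ 2 ≤ γ' / 4) (hwinκ : 12 * (β' * (4 / γ' + M * ((4 / γ') ^ 2 * (3 + a' * (2 * M + 1))))) ≤ Real.sqrt κ₁)
  (hρ : (6 * (β' * (4 / γ' + M * ((4 / γ') ^ 2 * (3 + a' * (2 * M + 1))))) + 9 * (β' * (4 / γ' + M * ((4 / γ') ^ 2 * (3 + a' * (2 * M + 1)))))) /
    Real.sqrt κ₁ ≤ ρ)

/-! ## §1 The binder `hQK` inhabited at the chain -/

include hL hφ hφ' hMφ hMφ' hstar hc hη hU hRS hα1' hU1' hreg' hεU hUε hτ hMτ hδ hRe hIm ha' hγ' hγ'1 hκ₁ hM coercive hκ hMQ hℓ hℓ' hβ'0 hβ'1 hwin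
  hwinQ hwin' hβQ hβK hβ'D hβ'Q small' hwinκ hρ in
/-- **THE `hQK` BINDER OF (GBD v2) ∕ (H1D) ∕ (EH1) INHABITED AT THE CHAIN**: for every fine weight `χ` (increments `≤ ℓη`), one-block companion `χ′` (`≤ ℓ′`),
multipliers `M_B, M_S, M_F` and `‖κ‖ = r`: `dQ(β) ∧ dQ′(β) ∧ dK(β_K) ∧ dR(ρ)` at `Q := QtorusW`, `Δ′ := curvOp`, `R := RofU` — gen 94's companion letters for the
first three, ne9-leaf-03's `norm_conjRofU_sub_RofU_le_sqrtKappa` for the fourth (its six multipliers = the exponentials of `M_S, M_B` and of the coarse-site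
multiplier by `χ′`, which exists by `exists_pointwise_clm`). [cite: Balaban1985BackgroundPropagators, (3.15) p.393, (3.21) p.394, (3.25) p.394, (3.26) p.395,
(3.49) p.399, (3.69) p.404, Thm 3.11 p.416] -/
theorem hQK_of_chain :
    ∀ (χ : TSite d (fineP L m) → ℝ) (χ' : TSite d m → ℝ),
      (∀ b : Bond d (fineP L m), |χ (bpos b) - χ (btgt b)| ≤ ℓ * η) →
      (∀ (y : TSite d m), ∀ x ∈ B9Eq319QprimeTorus.blockOf L m y, |χ' y - χ x| ≤ ℓ') →
      ∀ (MB : BondL2K ℂ d (fineP L m) c₀ W →L[ℂ] BondL2K ℂ d (fineP L m) c₀ W),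
      (∀ (g : BondL2K ℂ d (fineP L m) c₀ W) (b : Bond d (fineP L m)),
        WL2.equiv ℂ (fun _ : Bond d (fineP L m) => c₀) W (MB g) b = (χ (bpos b) : ℂ) • WL2.equiv ℂ (fun _ : Bond d (fineP L m) => c₀) W g b) →
      ∀ (MS : SiteL2K ℂ d (fineP L m) c₀ W →L[ℂ] SiteL2K ℂ d (fineP L m) c₀ W),
      (∀ (g : SiteL2K ℂ d (fineP L m) c₀ W) (x : TSite d (fineP L m)),
        WL2.equiv ℂ (fun _ : TSite d (fineP L m) => c₀) W (MS g) x = (χ x : ℂ) • WL2.equiv ℂ (fun _ : TSite d (fineP L m) => c₀) W g x) →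
      ∀ (MF : BondL2K ℂ d m c₁ W →L[ℂ] BondL2K ℂ d m c₁ W),
      (∀ (g : BondL2K ℂ d m c₁ W) (b' : Bond d m),
        WL2.equiv ℂ (fun _ : Bond d m => c₁) W (MF g) b' = (χ' (bpos b') : ℂ) • WL2.equiv ℂ (fun _ : Bond d m => c₁) W g b') →
      ∀ κ : ℂ, ‖κ‖ = r →
      (∀ f, ‖exp (κ • MF) (QtorusW L m hL φ U hα1 hU1 hreg (c₀ := c₀) (c₁ := c₁) (exp (κ • (-MB)) f)) -
          QtorusW L m hL φ U hα1 hU1 hreg (c₀ := c₀) (c₁ := c₁) f‖ ≤ β * ‖f‖) ∧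
      (∀ g, ‖exp (κ • MB) (LinearMap.adjoint (QtorusW L m hL φ U hα1 hU1 hreg (c₀ := c₀) (c₁ := c₁)) (exp (κ • (-MF)) g)) -
          LinearMap.adjoint (QtorusW L m hL φ U hα1 hU1 hreg (c₀ := c₀) (c₁ := c₁)) g‖ ≤ β * ‖g‖) ∧
      (∀ f, ‖exp (κ • MB) (curvOp φ τ η U (exp (κ • (-MB)) f)) - curvOp φ τ η U f‖ ≤ βK * ‖f‖) ∧
      (∀ s, ‖exp (κ • MS) (RofU L m φ η U (c₀ := c₀) (exp (κ • (-MS)) s)) - RofU L m φ η U (c₀ := c₀) s‖ ≤ ρ * ‖s‖) := by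
  intro χ χ' hχ hχ' MB hMB MS hMS MF hMF κ hκr
  have hℓ0 : 0 ≤ ℓ := zero_le_one.trans hℓ
  have hℓ'0 : 0 ≤ ℓ' := zero_le_one.trans hℓ'
  have hι : 0 ≤ ℓ * η := mul_nonneg hℓ0 hη.le
  refine ⟨fun f => ?_, fun g => ?_, fun f => ?_, fun s => ?_⟩
  · -- dQ
    have hwinκ' : ‖κ‖ * (3 * ℓ' + L * (ℓ * η)) ≤ 1 := by rw [hκr]; exact hwinQ
    have h := norm_expConj_QtorusW_sub_le L m hL U hα1 hU1 hreg hα1' hU1' hreg' hεU hUε φ (c₀ := c₀) (c₁ := c₁) hMφ hφ hMφ' hφ' hι hℓ'0 hχ hχ'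
      hMB hMF hwinκ' f
    rw [hκr] at h
    exact h.trans (mul_le_mul_of_nonneg_right hβQ (norm_nonneg _))
  · -- dQ′
    have hwinκ' : ‖κ‖ * (3 * ℓ' + L * (ℓ * η)) ≤ 1 := by rw [hκr]; exact hwinQ
    have h := norm_expConj_adjoint_QtorusW_sub_le L m hL U hα1 hU1 hreg hα1' hU1' hreg' hεU hUε φ (c₀ := c₀) (c₁ := c₁) hMφ hφ hMφ' hφ' hι hℓ'0 hχ
      hχ' hMB hMF hwinκ' g
    rw [hκr] at h
    exact h.trans (mul_le_mul_of_nonneg_right hβQ (norm_nonneg _))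
  · -- dK
    have hwinK : ‖κ‖ * (ℓ * η) ≤ 1 := by rw [hκr, ← mul_assoc]; exact hwin
    have h := norm_expConj_curvOp_sub_le φ hφ hMφ hstar τ hτ hMτ η U hU hδ hRe hIm hι hχ hMB hwinK f
    rw [hκr] at h
    exact h.trans (mul_le_mul_of_nonneg_right hβK (norm_nonneg _))
  · -- dR: the coarse-site multiplier by `χ′` and ne9-leaf-03's chain letter
    obtain ⟨MG, hMG⟩ := exists_pointwise_clm (𝕜 := ℂ) (w := fun _ : TSite d m => c₁) (V := W) (fun y : TSite d m => y) χ'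
    have hwin1 : ‖κ‖ * ℓ * η ≤ 1 := by rw [hκr]; exact hwin
    have hwin2 : ‖κ‖ * ℓ' ≤ 1 := by rw [hκr]; exact hwin'
    have hβ'D' : 2 * ‖κ‖ * ℓ * (Mφ * Mφ') * Real.sqrt d ≤ β' := by rw [hκr]; exact hβ'D
    have hβ'Q' : 2 * ‖κ‖ * ℓ' * (1 + 2 * Mφ * Mφ' * εU) ^ (d * (L - 1)) ≤ β' := by rw [hκr]; exact hβ'Q
    have h := norm_conjRofU_sub_RofU_le_sqrtKappa (L := L) (m := m) hφ hφ' hMφ hMφ' hη hU hεU hUε hc ha' hRS hpos' hℓ0 hℓ'0 hχ hχ' hwin1 hwin2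
      (S := ((exp (κ • MS) : SiteL2K ℂ d (fineP L m) c₀ W →L[ℂ] SiteL2K ℂ d (fineP L m) c₀ W) :
        SiteL2K ℂ d (fineP L m) c₀ W →ₗ[ℂ] SiteL2K ℂ d (fineP L m) c₀ W))
      (Sinv := ((exp (κ • (-MS)) : SiteL2K ℂ d (fineP L m) c₀ W →L[ℂ] SiteL2K ℂ d (fineP L m) c₀ W) :
        SiteL2K ℂ d (fineP L m) c₀ W →ₗ[ℂ] SiteL2K ℂ d (fineP L m) c₀ W))
      (fun f x => equiv_exp_smul_apply_complex MS χ hMS κ f x) (fun f x => equiv_exp_smul_neg_apply_complex MS χ hMS κ f x)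
      (SB := ((exp (κ • MB) : BondL2K ℂ d (fineP L m) c₀ W →L[ℂ] BondL2K ℂ d (fineP L m) c₀ W) :
        BondL2K ℂ d (fineP L m) c₀ W →ₗ[ℂ] BondL2K ℂ d (fineP L m) c₀ W))
      (SBinv := ((exp (κ • (-MB)) : BondL2K ℂ d (fineP L m) c₀ W →L[ℂ] BondL2K ℂ d (fineP L m) c₀ W) :
        BondL2K ℂ d (fineP L m) c₀ W →ₗ[ℂ] BondL2K ℂ d (fineP L m) c₀ W))
      (fun g b => equiv_exp_smul_apply_complex MB (fun b => χ (bpos b)) hMB κ g b)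
      (fun g b => equiv_exp_smul_neg_apply_complex MB (fun b => χ (bpos b)) hMB κ g b)
      (SG := ((exp (κ • MG) : SiteL2K ℂ d m c₁ W →L[ℂ] SiteL2K ℂ d m c₁ W) : SiteL2K ℂ d m c₁ W →ₗ[ℂ] SiteL2K ℂ d m c₁ W))
      (SGinv := ((exp (κ • (-MG)) : SiteL2K ℂ d m c₁ W →L[ℂ] SiteL2K ℂ d m c₁ W) : SiteL2K ℂ d m c₁ W →ₗ[ℂ] SiteL2K ℂ d m c₁ W))
      (fun g y => equiv_exp_smul_apply_complex MG (fun y => χ' y) hMG κ g y)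
      (fun g y => equiv_exp_smul_neg_apply_complex MG (fun y => χ' y) hMG κ g y)
      hγ' hγ'1 hκ₁ hM hβ'0 hβ'1 coercive hκ hMQ hβ'D' hβ'Q' small' hwinκ s
    simp only [ContinuousLinearMap.coe_coe] at h
    exact h.trans (mul_le_mul_of_nonneg_right hρ (norm_nonneg _))

/-! ## §2 The corollary: the `L²` block decay of `G₁(U)` with `hQK` discharged -/

include hφ hφ' hMφ hMφ' hstar hc hη hηL hU hRS hα1' hU1' hreg' hεU hUε hτ hMτ hδ hRe hIm ha' hγ' hγ'1 hκ₁ hM coercive hκ hMQ hr hℓ hℓ' hβ'0 hβ'1 hwin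
  hwinQ hwin' hβQ hβK hβ'D hβ'Q small' hwinκ hρ in
/-- **THE `L²` BLOCK DECAY OF `G₁(U) = Δ_a(U)⁻¹` WITH THE CONJUGATION LETTERS DISCHARGED**: `Δ_a(U)` at `Q := QtorusW`; displayed: `γ` (Thm 3.11) + `hpos`,
`γ′, a′, hpos′, κ₁, M` (the `G′` side), `C_P` + `hP`, the MODEL letters and the CLOSED windows (`β ≥ 0`, `ρ ≥ 0`, `ρ ≤ 1∕8`, `4rℓM_φM_φ′d√d ≤ β`, `4rℓM_φM_φ′d ≤ β`,
`2rℓM_φM_φ′√d ≤ β`, `p_K∕2 + (21+3a)β² + 4βC_P + 2ρC_P² + β_K ≤ γ∕4` with `p_K` the (3.69) constant of `B9Eq369CurvFormL2`): for every bond-block family and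
every pair of coarse sites `‖P_{y₁} ∘ G₁(U) ∘ P_{y₀}‖ ≤ (4∕γ)·e^{r}·e^{−r·d_m(y₀,y₁)}` — (GBD v2) `norm_block_G1ofU_le` with `hQK := hQK_of_chain` and the `p_K`
floor from g92. [cite: Balaban1985BackgroundPropagators, (3.26) p.395, Thm 3.11 p.416, (3.49) p.399; Balaban1985Variational, (110) p.294] -/
theorem norm_block_G1ofU_le_closedLetters (a : ℝ) (ha : 0 ≤ a) (hm : ∀ i, 1 ≤ m i)
    (hpos : ∀ x : BondL2K ℂ d (fineP L m) c₀ W, x ≠ 0 →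
      0 < RCLike.re ⟪x, laplaceAofU L m φ η U τ (QtorusW L m hL φ U hα1 hU1 hreg (c₀ := c₀) (c₁ := c₁)) a x⟫_ℂ)
    {γ CP : ℝ} (hγ : 0 < γ) (hβ : 0 ≤ β) (hρ0 : 0 ≤ ρ) (hρ8 : ρ ≤ 1 / 8) (hCP : 0 ≤ CP)
    (hcoer : ∀ f : BondL2K ℂ d (fineP L m) c₀ W,
      γ * ‖f‖ ^ 2 ≤ RCLike.re ⟪f, laplaceAofU L m φ η U τ (QtorusW L m hL φ U hα1 hU1 hreg (c₀ := c₀) (c₁ := c₁)) a f⟫_ℂ)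
    (hβCC : 4 * r * ℓ * (Mφ * Mφ') * (d * Real.sqrt d) ≤ β) (hβC : 4 * r * ℓ * (Mφ * Mφ') * d ≤ β)
    (hβD : 2 * r * ℓ * (Mφ * Mφ') * Real.sqrt d ≤ β)
    (hP : ∀ f, ‖covDivL2K ℂ c₀ ((η : ℂ))⁻¹ (adTransportW φ fun b => (U b)⁻¹) f -
      RofU L m φ η U (c₀ := c₀) (covDivL2K ℂ c₀ ((η : ℂ))⁻¹ (adTransportW φ fun b => (U b)⁻¹) f)‖ ≤ CP * ‖f‖)
    (small : (768 * Fintype.card (DirPair d) * Mτ * Mφ ^ 2 * (‖((η : ℂ)) ^ d‖ / c₀) * ‖((η : ℂ))⁻¹‖ ^ 2 * δ) / 2 + (21 + 3 * a) * β ^ 2 +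
      4 * β * CP + 2 * ρ * CP ^ 2 + βK ≤ γ / 4)
    (PB : TSite d m → BondL2K ℂ d (fineP L m) c₀ W →L[ℂ] BondL2K ℂ d (fineP L m) c₀ W)
    (hPB : ∀ (y : TSite d m) (f : BondL2K ℂ d (fineP L m) c₀ W) (b : Bond d (fineP L m)),
      WL2.equiv ℂ (fun _ : Bond d (fineP L m) => c₀) W (PB y f) b =
        if blockCoord L m (bpos b) = y then WL2.equiv ℂ (fun _ : Bond d (fineP L m) => c₀) W f b else 0)
    (y₀ y₁ : TSite d m) :
    ‖PB y₁ ∘L LinearMap.toContinuousLinearMap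
        (G1ofU L m φ η U τ (Q := QtorusW L m hL φ U hα1 hU1 hreg (c₀ := c₀) (c₁ := c₁)) (a := a) hpos) ∘L PB y₀‖ ≤
      4 / γ * Real.exp r * Real.exp (-(r * tdist m y₀ y₁)) := by
  have hKre : ∀ f : BondL2K ℂ d (fineP L m) c₀ W,
      -((768 * Fintype.card (DirPair d) * Mτ * Mφ ^ 2 * (‖((η : ℂ)) ^ d‖ / c₀) * ‖((η : ℂ))⁻¹‖ ^ 2 * δ) * ‖f‖ ^ 2) ≤
        RCLike.re ⟪f, curvOp φ τ η U f⟫_ℂ :=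
    fun f => re_inner_curvOp_self_ge φ hφ hstar τ hτ hMτ η U (fun b => B7Prop1Explicit.mem_U1.mp (hU b)) hδ hRe hIm f
  exact norm_block_G1ofU_le φ hφ hφ' hMφ hMφ' hη hηL U hU hRS τ _ a ha hm hL hpos hγ hβ hℓ hℓ' hr hρ0 hρ8 hCP hcoer hKre hwin hβCC hβC hβD
    (hQK_of_chain L m hL φ hφ hφ' hMφ hMφ' hstar hc hη U hU hRS hα1 hU1 hreg hα1' hU1' hreg' hεU hUε τ hτ hMτ hδ hRe hIm ha' hpos' hγ' hγ'1 hκ₁ hM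
      coercive hκ hMQ hℓ hℓ' hβ'0 hβ'1 hwin hwinQ hwin' hβQ hβK hβ'D hβ'Q small' hwinκ hρ)
    hP small PB hPB y₀ y₁

/-! ## §3 … and with the complementary-projection letter discharged (`C_P := √(M∕√κ₁)`) -/

include hφ hφ' hMφ hMφ' hstar hc hη hηL hU hRS hα1' hU1' hreg' hεU hUε hτ hMτ hδ hRe hIm ha' hγ' hγ'1 hκ₁ hM coercive hκ hMQ hr hℓ hℓ' hβ'0 hβ'1 hwin
  hwinQ hwin' hβQ hβK hβ'D hβ'Q small' hwinκ hρ in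
/-- **THE `L²` BLOCK DECAY OF `G₁(U)`, CONJUGATION LETTERS AND `C_P` DISCHARGED**: §2 with `hP :=` ne9-leaf-03's
`B9Eq325ProjectionDivergenceQuarterKappa.norm_one_sub_RofU_covDivL2K_le_sqrt` (`C_P = √(M∕√κ₁)` from the `Q̃′` size `M` and the floor `κ₁` — «by energy
alone»).  Displayed now: `γ` + `hpos` (Thm 3.11 for `Δ_a`), `γ′, a′, hpos′, κ₁, M` (the `G′` side), the MODEL letters, the CLOSED windows with
`p_K∕2 + (21+3a)β² + 4β√(M∕√κ₁) + 2ρ(M∕√κ₁) + β_K ≤ γ∕4`. [cite: Balaban1985BackgroundPropagators, (3.26) p.395, (3.21)–(3.25) p.394, Thm 3.11 p.416, (3.49) p.399;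
Balaban1985Variational, (110) p.294] -/
theorem norm_block_G1ofU_le_closed (a : ℝ) (ha : 0 ≤ a) (hm : ∀ i, 1 ≤ m i)
    (hpos : ∀ x : BondL2K ℂ d (fineP L m) c₀ W, x ≠ 0 →
      0 < RCLike.re ⟪x, laplaceAofU L m φ η U τ (QtorusW L m hL φ U hα1 hU1 hreg (c₀ := c₀) (c₁ := c₁)) a x⟫_ℂ)
    {γ : ℝ} (hγ : 0 < γ) (hβ : 0 ≤ β) (hρ0 : 0 ≤ ρ) (hρ8 : ρ ≤ 1 / 8)
    (hcoer : ∀ f : BondL2K ℂ d (fineP L m) c₀ W,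
      γ * ‖f‖ ^ 2 ≤ RCLike.re ⟪f, laplaceAofU L m φ η U τ (QtorusW L m hL φ U hα1 hU1 hreg (c₀ := c₀) (c₁ := c₁)) a f⟫_ℂ)
    (hβCC : 4 * r * ℓ * (Mφ * Mφ') * (d * Real.sqrt d) ≤ β) (hβC : 4 * r * ℓ * (Mφ * Mφ') * d ≤ β)
    (hβD : 2 * r * ℓ * (Mφ * Mφ') * Real.sqrt d ≤ β)
    (small : (768 * Fintype.card (DirPair d) * Mτ * Mφ ^ 2 * (‖((η : ℂ)) ^ d‖ / c₀) * ‖((η : ℂ))⁻¹‖ ^ 2 * δ) / 2 + (21 + 3 * a) * β ^ 2 +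
      4 * β * Real.sqrt (M / Real.sqrt κ₁) + 2 * ρ * (Real.sqrt (M / Real.sqrt κ₁)) ^ 2 + βK ≤ γ / 4)
    (PB : TSite d m → BondL2K ℂ d (fineP L m) c₀ W →L[ℂ] BondL2K ℂ d (fineP L m) c₀ W)
    (hPB : ∀ (y : TSite d m) (f : BondL2K ℂ d (fineP L m) c₀ W) (b : Bond d (fineP L m)),
      WL2.equiv ℂ (fun _ : Bond d (fineP L m) => c₀) W (PB y f) b =
        if blockCoord L m (bpos b) = y then WL2.equiv ℂ (fun _ : Bond d (fineP L m) => c₀) W f b else 0)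
    (y₀ y₁ : TSite d m) :
    ‖PB y₁ ∘L LinearMap.toContinuousLinearMap
        (G1ofU L m φ η U τ (Q := QtorusW L m hL φ U hα1 hU1 hreg (c₀ := c₀) (c₁ := c₁)) (a := a) hpos) ∘L PB y₀‖ ≤
      4 / γ * Real.exp r * Real.exp (-(r * tdist m y₀ y₁)) :=
  norm_block_G1ofU_le_closedLetters L m hL φ hφ hφ' hMφ hMφ' hstar hc hη hηL U hU hRS hα1 hU1 hreg hα1' hU1' hreg' hεU hUε τ hτ hMτ hδ hRe hIm ha' hpos'
    hγ' hγ'1 hκ₁ hM coercive hκ hMQ hr hℓ hℓ' hβ'0 hβ'1 hwin hwinQ hwin' hβQ hβK hβ'D hβ'Q small' hwinκ hρ a ha hm hpos hγ hβ hρ0 hρ8 (by positivity) hcoer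
    hβCC hβC hβD
    (B9Eq325ProjectionDivergenceQuarterKappa.norm_one_sub_RofU_covDivL2K_le_sqrt L m φ c₀ η U c₁ a' hRS hpos' ha' hM hκ₁ hMQ hκ)
    small PB hPB y₀ y₁

end Literature.MathematicalPhysics.QuantumFieldTheory.Balaban1983to89.B9Eq326DeltaAHQKLetters

end
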